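import Summits.Parity.GeneralizedHardyLittlewood.Theses.ZDegreeToeplitzBand

/-! POST-OPEN v3 (crit-1 g3: single crux-concluding theorem; v2 by typer-1 g4) VARIANT v2 of the BIRTH SKELETON (BC3) — v2 (typer-1 g4, ls-lead 04:15:07Z shape rule): the hypothesis-free theorem is named `<Crux>_of`, the composition with the stub signatures as hypotheses is `<Crux>_comp`; — critic ls-knife-crit-1 g3 probe: imports the opened route module, drops the local def copy.
ORIGINAL HEADER: for route `ZDegreeToeplitzBand` — statements only; sorries ONLY inside `stub_*`.
The programme SEARCHES and TYPES; no claim about Landau–Siegel zeros, Theorems 1–2 of arXiv:2211.02515 or a repaired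
Margin232 until a kernel theorem says so. -/

namespace Summit.Parity.GeneralizedHardyLittlewood.Theses.ZDegreeToeplitzBand

open Literature.NumberTheory.LFunctions.Zhang2022

-- (post-open: `InClassSideTables` is now the TREE decl; local copy dropped)

/-- stub 1 · UPPER half of the (8.23) dictionary for a general kinked piece, eventually in c′: under (A), eventually,
Σ𝔠*|H_u|²ω ≤ (𝔅(u) + ε)𝔞𝔓 — the direction Zhang's positivity argument consumes; mean-square MAJORANT technology
(tree Section7MeanSquareMajorant) plus the main-term evaluation from above. -/
theorem stub_sideUpper :
    ∃ c₀ : ℝ, ∀ c' : ℝ, c₀ ≤ c' → ∀ (u u' : ℝ → ℂ), Repair.KinkedProfile u u' → ∀ ε : ℝ, 0 < ε →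
      Skeleton.ForAllLarge fun D _ χ => Skeleton.AssumptionA D χ →
        KnifeEdge.discMean c' χ (fun x t => KnifeEdge.profPoly χ x u (⌊Skeleton.bigP D⌋₊ + 1) t)
            - mainTermForm u u' * Skeleton.frakA χ * frakP D
          ≤ ε * Skeleton.frakA χ * frakP D := by
  sorry

/-- stub 2 · LOWER half: Σ𝔠*|H_u|²ω ≥ (𝔅(u) − ε)𝔞𝔓 — needs the full Prop 7.1 evaluation (S_j against a kinked profile)
with o(𝔞𝔓) errors: the genuine derivation-debt (critic pin P-debt). HARDEST of the two. -/
theorem stub_sideLower :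
    ∃ c₀ : ℝ, ∀ c' : ℝ, c₀ ≤ c' → ∀ (u u' : ℝ → ℂ), Repair.KinkedProfile u u' → ∀ ε : ℝ, 0 < ε →
      Skeleton.ForAllLarge fun D _ χ => Skeleton.AssumptionA D χ →
        -(ε * Skeleton.frakA χ * frakP D) ≤
          KnifeEdge.discMean c' χ (fun x t => KnifeEdge.profPoly χ x u (⌊Skeleton.bigP D⌋₊ + 1) t)
            - mainTermForm u u' * Skeleton.frakA χ * frakP D := by
  sorry

/-- **`InClassSideTables_of : InClassSideTables`** — K0 from the two halves BY NAME (thresholds maxed; `ForAllLarge.and`;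
`abs_le`); the ONLY theorem of the file that concludes the crux. -/
theorem InClassSideTables_of : InClassSideTables := by
  obtain ⟨c₁, h₁⟩ := stub_sideUpper
  obtain ⟨c₂, h₂⟩ := stub_sideLower
  refine ⟨max c₁ c₂, fun c' hc' u u' hu ε hε => ?_⟩
  have hU := h₁ c' (le_trans (le_max_left _ _) hc') u u' hu ε hε
  have hL := h₂ c' (le_trans (le_max_right _ _) hc') u u' hu ε hε
  refine (Skeleton.ForAllLarge.and hU hL).mono ?_
  intro D _ χ _ _ h hA
  exact abs_le.mpr ⟨(h.2 hA), (h.1 hA)⟩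

end Summit.Parity.GeneralizedHardyLittlewood.Theses.ZDegreeToeplitzBand
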